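import Mathlib
import HarnessLib
import Summits.HubbardSuperconductivity.HubbardSuperconductivity.Theorems.KLProgrammeKLRegimeSplitEdgeFactsRelativeLines

/-!
# Route `KLProgramme` — ENGINE child gen 8 (stmt-HubbardSuperconductivity-20437 `KLRegimeEngineV17F2`), skeleton v2 class #5 «(S)-transfer», TEXT REV 3 (working
# text-elect, plan g20 (R54f)/(R54g)): the RELATIVE FAMILY — soft mass, shell count, member arrays, `PairTransferRelAt`/`PairTransferRelFamily`, the bridge to rev 2
# (cell gate-hubbard-kl, seat hubbard-kl-k3c1-p1 g10; text owner p1 lineage — this file is the G1 DEFINITIONS draft the pen asked this seat to land)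

WHY (CLASS5-DEFECT-BUDGET b3e7bdaa64abed99, CLASS5-DEFECT-BUDGET-2 e1cd66a0d1607802, evidence on 20437).  Rev 2's pinned step (`PairTransferStep2`,
`…EngineV8PairTransferExport2`) cannot be produced by composition through the resummation square: the inherited residue and the plain step's residue are paid additively
while `transferBarAt` is gained.  The closable organisation compares TWO MEMBERS directly and never re-bases on the plain array inside the step: the RELATIVE clause
of a pair of admissible symbols `(ψ₁ | ψ₂)` says that the member array of `ψ₁` is the member array of `ψ₂` resummed with the RELATIVE pinned weight
`tₙ[ψ₁] − tₙ[ψ₂]`, up to a residue measured in units of the SOFT MASS of `ψ₁ − ψ₂` relative to the running scale — which quadruples per step for a fixed symbol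
(`klSoftMass_succ`), the contraction that gives coefficient-1 inheritance room (door: `kltc_relative_flow_duhamel` p583555 / `kltc_relative_step_fwd` p584594).

* §1 `klSoftMass β μ K n φ := (Λₙ·βL²)⁻¹·Σ_k |φ(k)|·‖ĝ_K(k)‖` (p1 g12's currency, CLASS5-REL-TEXT-g12; `‖ĝ_K‖ = 1/√(ω²+e_K²)`) — even, subadditive, monotone,
  **`klSoftMass (n+1) = 4·klSoftMass n`**, `≤ 15367` for `0 ≤ φ ≤ 1 − w^K_{Λₙ}` and `≤ 15367·4^{−(m−n)}` for `φ` admissible at the deeper scale `m` on a `FrameOK` frame with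
  `klBetaMin ≤ β ≤ L` (p581438/p583823), `Σ_p|tₙ[D]| ≤ 4·klSoftMass n D` (p583823 `sum_abs_klTransferWeight_le_softSum`); `klShellCount n ρ := #{j ≤ n : Λ_j ≤ ρ}` (the frozen-transfer shell count of
  CLASS5-DEFECT-BUDGET-2 §3–4); `klShellOverlap` (the born-overlap weight of the `ρ = 0` floor: the part of the soft mass inside the scale-`n` transition band).
* §2 `klMemberArrayF β U μ n ψ Qm` — the ball-truncated array of the member `ψ` at the flowing frame `Kₙ` (`= klPairArrayF` at `ψ = 0`: `klMemberArrayF_zero`).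
* §3 **`PairTransferRelAt L M β U μ n Tb ψ₁ ψ₂`** (bar `Tb` a PARAMETER — the text owner plugs the slot list of CLASS5-DEFECT-BUDGET-2 §3), **`PairTransferRelFamily … n TB`**
  (all ordered admissible pairs), `PairTransferRelAt.refl`, and the BRIDGE **`pairTransferPinnedAt_of_rel`**: the pair `(ψ | 0)` with `Tb ≤ transferBarAt … n` IS rev 2's
  `PairTransferPinnedAt … n ψ` — so the consumer clause, step 3 (p546910/p580253/p581707 §3) and every model line of the pinned weight are untouched.
Definitions with bodies + bookkeeping lemmas; nothing about the model is asserted (the relative clauses are the class-#5 producer's obligation).  0 kit.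
-/

noncomputable section

namespace Summit.HubbardSuperconductivity.HubbardSuperconductivity.Theorems.KLRegimeSplit

set_option linter.dupNamespace false -- summit = problem name (single-conjunct summit), D-0017

open Real Finset Matrix Literature.MathematicalPhysics.QuantumLattice Literature.Probability.LatticeModels
open Summit.HubbardSuperconductivity.HubbardSuperconductivity.Theorems.KLProgrammeLegKernels
open Summit.HubbardSuperconductivity.HubbardSuperconductivity.Theorems.TwoPointAssembly
open Summit.HubbardSuperconductivity.HubbardSuperconductivity.Theorems.DispersionFlow

/-! ## §1 Soft mass, shell count, born overlap -/

section SoftMass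

variable (L M : ℕ) [NeZero L]

/-- **The soft mass of a symbol `φ` at scale `n`, frame `K`**: `(Λₙ·βL²)⁻¹·Σ_k |φ(k)|·‖ĝ_K(k)‖` — the phase-space mass of the soft line `φ·ĝ_K` measured in units of the
running scale `Λₙ = klScale klE0 n` (the currency of `sum_softSymbol_mul_norm_propCT_le_of_frameOK` / `sum_abs_klTransferWeight_le_softSum`). -/
def klSoftMass (β μ : ℝ) (K : TrigPolyC4v) (n : ℕ) (φ : FreqMomentum L M → ℝ) : ℝ :=
  (klScale klE0 n * (β * (L : ℝ) ^ 2))⁻¹ * ∑ k : FreqMomentum L M, |φ k| * ‖propCT L M β μ K k‖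

/-- **The born-overlap weight at scale `n`**: the part of the soft mass of `φ` carried by the scale-`n` transition band `Λₙ²/4 ≤ ω² + e_K² ≤ Λₙ²` (the only place where a
line of slice `n` and a line of `φ` can coincide at zero transfer; CLASS5-DEFECT-BUDGET-2 §3). -/
def klShellOverlap (β μ : ℝ) (K : TrigPolyC4v) (n : ℕ) (φ : FreqMomentum L M → ℝ) : ℝ :=
  (klScale klE0 n * (β * (L : ℝ) ^ 2))⁻¹ *
    ∑ k : FreqMomentum L M,
      (if klScale klE0 n ^ 2 / 4 ≤ matsubaraFreq β M k.1 ^ 2 + nambuXiCT L μ K k.2 ^ 2 ∧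
          matsubaraFreq β M k.1 ^ 2 + nambuXiCT L μ K k.2 ^ 2 ≤ klScale klE0 n ^ 2 then |φ k| * ‖propCT L M β μ K k‖ else 0)

variable {L M}

/-- **The frozen-transfer shell count** `kₙ(ρ) = #{j ≤ n : Λ_j ≤ ρ}` (the number of hard shells below the transfer `ρ`; CLASS5-DEFECT-BUDGET-2 §3–4). -/
def klShellCount (n : ℕ) (ρ : ℝ) : ℕ := ((range (n + 1)).filter fun j => klScale klE0 j ≤ ρ).card

/-- `kₙ(ρ) ≤ n + 1`. -/
theorem klShellCount_le (n : ℕ) (ρ : ℝ) : klShellCount n ρ ≤ n + 1 :=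
  (card_filter_le _ _).trans (by simp)

/-- `kₙ(ρ)` is monotone in `n`. -/
theorem klShellCount_mono {n m : ℕ} (h : n ≤ m) (ρ : ℝ) : klShellCount n ρ ≤ klShellCount m ρ := by
  unfold klShellCount
  exact card_le_card (filter_subset_filter _ (range_subset_range.mpr (by omega)))

/-- Below the running scale no shell is counted: `ρ < Λₙ ⇒ kₙ(ρ) = 0` (`Λ_j ≥ Λₙ` for `j ≤ n`). -/
theorem klShellCount_eq_zero_of_lt {n : ℕ} {ρ : ℝ} (h : ρ < klScale klE0 n) : klShellCount n ρ = 0 := by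
  unfold klShellCount
  rw [card_eq_zero, filter_eq_empty_iff]
  intro j hj hle
  have hjn : j ≤ n := by simpa [mem_range, Nat.lt_succ_iff] using hj
  have hmono : klScale klE0 n ≤ klScale klE0 j := by
    unfold klScale
    have hE0 : (0 : ℝ) ≤ klE0 := by norm_num [klE0]
    exact mul_le_mul_of_nonneg_left (inv_anti₀ (by positivity) (pow_le_pow_right₀ (by norm_num) hjn)) hE0
  linarith

variable (β μ : ℝ) (K : TrigPolyC4v)

/-- The soft mass of the zero symbol is `0`. -/
theorem klSoftMass_zero (n : ℕ) : klSoftMass L M β μ K n (fun _ => 0) = 0 := by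
  simp [klSoftMass]

/-- The soft mass is even: `klSoftMass n (−φ) = klSoftMass n φ`. -/
theorem klSoftMass_neg (n : ℕ) (φ : FreqMomentum L M → ℝ) : klSoftMass L M β μ K n (-φ) = klSoftMass L M β μ K n φ := by
  simp [klSoftMass, abs_neg]

/-- Hence symmetric in a difference: `klSoftMass n (φ − ψ) = klSoftMass n (ψ − φ)`. -/
theorem klSoftMass_sub_comm (n : ℕ) (φ ψ : FreqMomentum L M → ℝ) : klSoftMass L M β μ K n (φ - ψ) = klSoftMass L M β μ K n (ψ - φ) := by
  rw [← klSoftMass_neg β μ K n (φ - ψ), neg_sub]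

/-- The soft mass is nonnegative (for `0 < β`). -/
theorem klSoftMass_nonneg (hβ : 0 < β) (n : ℕ) (φ : FreqMomentum L M → ℝ) : 0 ≤ klSoftMass L M β μ K n φ := by
  unfold klSoftMass
  have hΛ : 0 < klScale klE0 n := klth_klScale_pos n
  exact mul_nonneg (by positivity) (sum_nonneg fun k _ => mul_nonneg (abs_nonneg _) (norm_nonneg _))

/-- The soft mass is monotone in the absolute value of the symbol (for `0 < β`). -/
theorem klSoftMass_mono (hβ : 0 < β) (n : ℕ) {φ ψ : FreqMomentum L M → ℝ} (h : ∀ k, |φ k| ≤ |ψ k|) :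
    klSoftMass L M β μ K n φ ≤ klSoftMass L M β μ K n ψ := by
  unfold klSoftMass
  have hΛ : 0 < klScale klE0 n := klth_klScale_pos n
  refine mul_le_mul_of_nonneg_left (sum_le_sum fun k _ => ?_) (by positivity)
  exact mul_le_mul_of_nonneg_right (h k) (norm_nonneg _)

/-- The soft mass is subadditive (for `0 < β`). -/
theorem klSoftMass_add_le (hβ : 0 < β) (n : ℕ) (φ ψ : FreqMomentum L M → ℝ) :
    klSoftMass L M β μ K n (φ + ψ) ≤ klSoftMass L M β μ K n φ + klSoftMass L M β μ K n ψ := by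
  unfold klSoftMass
  have hΛ : 0 < klScale klE0 n := klth_klScale_pos n
  rw [← mul_add, ← sum_add_distrib]
  refine mul_le_mul_of_nonneg_left (sum_le_sum fun k _ => ?_) (by positivity)
  rw [← add_mul, Pi.add_apply]
  exact mul_le_mul_of_nonneg_right (abs_add_le _ _) (norm_nonneg _)

/-- **THE CONTRACTION**: for a fixed symbol the soft mass QUADRUPLES per step — `klSoftMass (n+1) φ = 4·klSoftMass n φ` (`Λ_{n+1} = Λₙ/4`). -/
theorem klSoftMass_succ (n : ℕ) (φ : FreqMomentum L M → ℝ) : klSoftMass L M β μ K (n + 1) φ = 4 * klSoftMass L M β μ K n φ := by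
  unfold klSoftMass
  rw [klth_klScale_succ]
  have h : (klScale klE0 n / 4 * (β * (L : ℝ) ^ 2))⁻¹ = 4 * (klScale klE0 n * (β * (L : ℝ) ^ 2))⁻¹ := by
    rw [show klScale klE0 n / 4 * (β * (L : ℝ) ^ 2) = (klScale klE0 n * (β * (L : ℝ) ^ 2)) / 4 by ring, inv_div, div_eq_mul_inv]
  rw [h, mul_assoc]

/-- Iterated: `klSoftMass (n+j) φ = 4^j·klSoftMass n φ`. -/
theorem klSoftMass_add_eq_pow_mul (n j : ℕ) (φ : FreqMomentum L M → ℝ) : klSoftMass L M β μ K (n + j) φ = (4 : ℝ) ^ j * klSoftMass L M β μ K n φ := by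
  induction j with
  | zero => simp
  | succ j ih => rw [← add_assoc, klSoftMass_succ, ih, pow_succ]; ring

/-- **Mass of the pinned weight of any symbol, keyed**: `Σ_p |tₙ[D](Qm,p)| ≤ 4·klSoftMass n D` (p583823 `sum_abs_klTransferWeight_le_softSum`). -/
theorem sum_abs_klTransferWeight_le_klSoftMass (hβ : 0 < β) (n : ℕ) (D : FreqMomentum L M → ℝ) (Qm : TorusSite 2 L) :
    ∑ p, |klTransferWeight L M β μ K n D Qm p| ≤ 4 * klSoftMass L M β μ K n D := by
  refine (sum_abs_klTransferWeight_le_softSum β μ K hβ n D Qm).trans (le_of_eq ?_)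
  unfold klSoftMass
  have hΛ : klScale klE0 n ≠ 0 := (klth_klScale_pos n).ne'
  rw [mul_inv, ← mul_assoc, ← mul_assoc]
  congr 1
  rw [div_eq_mul_inv]
  ring

/-- **Mass of the RELATIVE pinned weight**: `Σ_p |tₙ[ψ₁](Qm,p) − tₙ[ψ₂](Qm,p)| ≤ 4·klSoftMass n (ψ₁ − ψ₂)` (p583823 `klTransferWeight_sub`). -/
theorem sum_abs_klTransferWeight_sub_le_klSoftMass (hβ : 0 < β) (n : ℕ) (ψ₁ ψ₂ : FreqMomentum L M → ℝ) (Qm : TorusSite 2 L) :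
    ∑ p, |klTransferWeight L M β μ K n ψ₁ Qm p - klTransferWeight L M β μ K n ψ₂ Qm p| ≤ 4 * klSoftMass L M β μ K n (ψ₁ - ψ₂) := by
  have h : ∀ p, klTransferWeight L M β μ K n ψ₁ Qm p - klTransferWeight L M β μ K n ψ₂ Qm p = klTransferWeight L M β μ K n (ψ₁ - ψ₂) Qm p :=
    fun p => klTransferWeight_sub β μ K n ψ₁ ψ₂ Qm p
  simp_rw [h]
  exact sum_abs_klTransferWeight_le_klSoftMass β μ K hβ n _ Qm

/-- The born overlap is nonnegative (for `0 < β`). -/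
theorem klShellOverlap_nonneg (hβ : 0 < β) (n : ℕ) (φ : FreqMomentum L M → ℝ) : 0 ≤ klShellOverlap L M β μ K n φ := by
  unfold klShellOverlap
  have hΛ : 0 < klScale klE0 n := klth_klScale_pos n
  refine mul_nonneg (by positivity) (sum_nonneg fun k _ => ?_)
  split_ifs
  · exact mul_nonneg (abs_nonneg _) (norm_nonneg _)
  · exact le_rfl

/-- The born overlap is at most the soft mass (for `0 < β`). -/
theorem klShellOverlap_le_klSoftMass (hβ : 0 < β) (n : ℕ) (φ : FreqMomentum L M → ℝ) : klShellOverlap L M β μ K n φ ≤ klSoftMass L M β μ K n φ := by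
  unfold klShellOverlap klSoftMass
  have hΛ : 0 < klScale klE0 n := klth_klScale_pos n
  refine mul_le_mul_of_nonneg_left (sum_le_sum fun k _ => ?_) (by positivity)
  split_ifs
  · exact le_rfl
  · exact mul_nonneg (abs_nonneg _) (norm_nonneg _)

end SoftMass

section SoftMassFrame

variable {L M : ℕ} [NeZero L] {R : RenConsts} {U : ℝ} {N : ℕ} {β μ : ℝ} {K : TrigPolyC4v}

/-- **The soft mass of an admissible symbol is at most `15367`** on a `FrameOK` frame, `klBetaMin ≤ β ≤ L`, EVERY `n` (p581438
`sum_softSymbol_mul_norm_propCT_le_of_frameOK`; the `Λₙ` cancels). -/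
theorem klSoftMass_le_of_frameOK (hK : FrameOK R U N μ K) (hβ : klBetaMin ≤ β) (hβL : β ≤ L) (n : ℕ) {φ : FreqMomentum L M → ℝ}
    (hφ : ∀ k, 0 ≤ φ k ∧ φ k ≤ 1 - hubbardCutoffWeightCT L M β μ K (klScale klE0 n) k) : klSoftMass L M β μ K n φ ≤ 15367 := by
  have hβ0 : 0 < β := pos_of_klBetaMin_le hβ
  have hΛ : 0 < klScale klE0 n := klth_klScale_pos n
  have hL : (0 : ℝ) < L := lt_of_lt_of_le hβ0 hβL
  have h := sum_softSymbol_mul_norm_propCT_le_of_frameOK β μ K hK hβ hβL n hφ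
  unfold klSoftMass
  have hc : 0 ≤ (klScale klE0 n * (β * (L : ℝ) ^ 2))⁻¹ := by positivity
  refine (mul_le_mul_of_nonneg_left h hc).trans (le_of_eq ?_)
  field_simp

/-- The admissible form (`IsSoftSymbol`). -/
theorem klSoftMass_le_of_isSoftSymbol (hK : FrameOK R U N μ K) (hβ : klBetaMin ≤ β) (hβL : β ≤ L) {n : ℕ} {φ : FreqMomentum L M → ℝ}
    (hφ : IsSoftSymbol L M β μ K n φ) : klSoftMass L M β μ K n φ ≤ 15367 :=
  klSoftMass_le_of_frameOK hK hβ hβL n hφ.1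

/-- **A symbol admissible at the DEEPER scale `m ≥ n` has soft mass `≤ 15367·4^{−(m−n)}` at scale `n`** (p583823 `sum_softSymbol_mul_norm_propCT_le_deep`) — the
history pairs of deep members carry correspondingly small relative bars. -/
theorem klSoftMass_le_deep (hK : FrameOK R U N μ K) (hβ : klBetaMin ≤ β) (hβL : β ≤ L) {n m : ℕ} (hnm : n ≤ m) {φ : FreqMomentum L M → ℝ}
    (hφ : ∀ k, 0 ≤ φ k ∧ φ k ≤ 1 - hubbardCutoffWeightCT L M β μ K (klScale klE0 m) k) :
    klSoftMass L M β μ K n φ ≤ 15367 * ((4 : ℝ) ^ (m - n))⁻¹ := by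
  have hβ0 : 0 < β := pos_of_klBetaMin_le hβ
  have hΛ : 0 < klScale klE0 n := klth_klScale_pos n
  have hL : (0 : ℝ) < L := lt_of_lt_of_le hβ0 hβL
  have h := sum_softSymbol_mul_norm_propCT_le_deep β μ K hK hβ hβL hnm hφ
  unfold klSoftMass
  have hc : 0 ≤ (klScale klE0 n * (β * (L : ℝ) ^ 2))⁻¹ := by positivity
  refine (mul_le_mul_of_nonneg_left h hc).trans (le_of_eq ?_)
  field_simp

end SoftMassFrame

/-! ## §2 The member arrays -/

section Member

variable (L M : ℕ) [NeZero L] [NeZero M]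

/-- **The ball-truncated array of the member `ψ` at scale `n`** (flowing frame `Kₙ`, smearing covariance `softCovOf … (Kₙ) ψ`): on the bare ball the smeared pair
amplitude `klCovSmearedPairAmplitude … (Kₙ) n (softCovOf ψ) Qm k k′`, zero off it. -/
def klMemberArrayF (β U μ : ℝ) (n : ℕ) (ψ : FreqMomentum L M → ℝ) (Qm : TorusSite 2 L) : Matrix (TorusSite 2 L) (TorusSite 2 L) ℂ :=
  Matrix.of fun k k' => if k ∈ klBall L μ 0 ∧ k' ∈ klBall L μ 0 then
    klCovSmearedPairAmplitude L M β U μ (klFlowFrameU L M β U μ n) n (softCovOf L M β μ (klFlowFrameU L M β U μ n) ψ) Qm k k' else 0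

variable {L M}

/-- On the bare ball the member array IS the smeared amplitude. -/
@[simp] theorem klMemberArrayF_apply_of_mem (β U μ : ℝ) (n : ℕ) (ψ : FreqMomentum L M → ℝ) (Qm : TorusSite 2 L) {k k' : TorusSite 2 L}
    (hk : k ∈ klBall L μ 0) (hk' : k' ∈ klBall L μ 0) :
    klMemberArrayF L M β U μ n ψ Qm k k' =
      klCovSmearedPairAmplitude L M β U μ (klFlowFrameU L M β U μ n) n (softCovOf L M β μ (klFlowFrameU L M β U μ n) ψ) Qm k k' := by
  simp [klMemberArrayF, hk, hk']

/-- Off the bare ball the member array vanishes. -/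
theorem klMemberArrayF_eq_zero_off (β U μ : ℝ) (n : ℕ) (ψ : FreqMomentum L M → ℝ) (Qm : TorusSite 2 L) {x y : TorusSite 2 L}
    (hxy : ¬(x ∈ klBall L μ 0 ∧ y ∈ klBall L μ 0)) : klMemberArrayF L M β U μ n ψ Qm x y = 0 := by
  simp [klMemberArrayF, hxy]

/-- **The PLAIN member**: at `ψ = 0` the member array is the public plain array `klPairArrayF n Qm`. -/
theorem klMemberArrayF_zero (β U μ : ℝ) (n : ℕ) (Qm : TorusSite 2 L) : klMemberArrayF L M β U μ n (fun _ => 0) Qm = klPairArrayF L M β U μ n Qm := by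
  ext k k'
  by_cases h : k ∈ klBall L μ 0 ∧ k' ∈ klBall L μ 0
  · rw [klMemberArrayF_apply_of_mem β U μ n _ Qm h.1 h.2, klPairArrayF_apply_of_mem L M β U μ n Qm h.1 h.2, softCovOf_zero,
      klCovSmearedPairAmplitude_zero]
  · rw [klMemberArrayF_eq_zero_off β U μ n _ Qm h]
    unfold klPairArrayF
    simp [h]

end Member

/-! ## §3 The relative clause, the relative family, the bridge to rev 2 -/

section Relative

variable (L M : ℕ) [NeZero L] [NeZero M]

/-- **`PairTransferRelAt L M β U μ n Tb ψ₁ ψ₂`** — the RELATIVE transfer clause of the pair `(ψ₁ | ψ₂)` at scale `n` with residue bar `Tb`: for every pair class `Qm` at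
resolution `n`, a TWO-SIDED inverse `N` of `1 − diag(tₙ[ψ₁] − tₙ[ψ₂])·A°ₙ[ψ₂]` (`tₙ = klTransferWeight … (Kₙ) n`, `A° = klMemberArrayF`) and ON THE BARE BALL
`‖A°ₙ[ψ₁](k,k′) − (A°ₙ[ψ₂]·N)(k,k′)‖ ≤ Tb Qm k k′`. -/
def PairTransferRelAt (β U μ : ℝ) (n : ℕ) (Tb : TorusSite 2 L → TorusSite 2 L → TorusSite 2 L → ℝ) (ψ₁ ψ₂ : FreqMomentum L M → ℝ) : Prop :=
  ∀ Qm : TorusSite 2 L, IsPairClassAt L Qm n →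
    ∃ N : Matrix (TorusSite 2 L) (TorusSite 2 L) ℂ,
      (1 - diagonal (fun p => ((klTransferWeight L M β μ (klFlowFrameU L M β U μ n) n ψ₁ Qm p -
          klTransferWeight L M β μ (klFlowFrameU L M β U μ n) n ψ₂ Qm p : ℝ) : ℂ)) * klMemberArrayF L M β U μ n ψ₂ Qm) * N = 1 ∧
      N * (1 - diagonal (fun p => ((klTransferWeight L M β μ (klFlowFrameU L M β U μ n) n ψ₁ Qm p -
          klTransferWeight L M β μ (klFlowFrameU L M β U μ n) n ψ₂ Qm p : ℝ) : ℂ)) * klMemberArrayF L M β U μ n ψ₂ Qm) = 1 ∧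
      ∀ k ∈ klBall L μ 0, ∀ k' ∈ klBall L μ 0,
        ‖klMemberArrayF L M β U μ n ψ₁ Qm k k' - (klMemberArrayF L M β U μ n ψ₂ Qm * N) k k'‖ ≤ Tb Qm k k'

/-- **`PairTransferRelFamily L M β U μ n TB`** — the relative clause at EVERY ordered pair of admissible symbols of the frame `Kₙ` at scale `n` (`ψ₂ ≤ ψ₁` pointwise),
with the pair-dependent bar `TB ψ₁ ψ₂` (the text owner's slot list in the soft mass / born overlap of `ψ₁ − ψ₂`, CLASS5-DEFECT-BUDGET-2 §3).  The invariant class #5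
rev 3 carries; its pair `(ψ | 0)` is rev 2's consumer clause (`pairTransferPinnedAt_of_rel`). -/
def PairTransferRelFamily (β U μ : ℝ) (n : ℕ)
    (TB : (FreqMomentum L M → ℝ) → (FreqMomentum L M → ℝ) → TorusSite 2 L → TorusSite 2 L → TorusSite 2 L → ℝ) : Prop :=
  ∀ ψ₁ ψ₂ : FreqMomentum L M → ℝ, IsSoftSymbol L M β μ (klFlowFrameU L M β U μ n) n ψ₁ → IsSoftSymbol L M β μ (klFlowFrameU L M β U μ n) n ψ₂ →
    (∀ k, ψ₂ k ≤ ψ₁ k) → PairTransferRelAt L M β U μ n (TB ψ₁ ψ₂) ψ₁ ψ₂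

variable {L M}

/-- The DIAGONAL pair `(ψ | ψ)` holds with any nonnegative bar (`N = 1`, residue `0`). -/
theorem PairTransferRelAt.refl {β U μ : ℝ} {n : ℕ} {Tb : TorusSite 2 L → TorusSite 2 L → TorusSite 2 L → ℝ} (hTb : ∀ Qm k k', 0 ≤ Tb Qm k k')
    (ψ : FreqMomentum L M → ℝ) : PairTransferRelAt L M β U μ n Tb ψ ψ := by
  intro Qm _
  refine ⟨1, ?_, ?_, fun k _ k' _ => ?_⟩
  · simp
  · simp
  · rw [Matrix.mul_one, sub_self, norm_zero]; exact hTb Qm k k'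
/-- Monotonicity of the relative clause in the bar. -/
theorem PairTransferRelAt.mono {β U μ : ℝ} {n : ℕ} {Tb Tb' : TorusSite 2 L → TorusSite 2 L → TorusSite 2 L → ℝ}
    {ψ₁ ψ₂ : FreqMomentum L M → ℝ} (h : PairTransferRelAt L M β U μ n Tb ψ₁ ψ₂) (hle : ∀ Qm k k', Tb Qm k k' ≤ Tb' Qm k k') :
    PairTransferRelAt L M β U μ n Tb' ψ₁ ψ₂ := by
  intro Qm hQm
  obtain ⟨N, h1, h2, hbd⟩ := h Qm hQm
  exact ⟨N, h1, h2, fun k hk k' hk' => (hbd k hk k' hk').trans (hle Qm k k')⟩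

/-- **BRIDGE to rev 2's consumer clause**: the pair `(ψ | 0)` with a bar dominated by `transferBarAt … n` IS `PairTransferPinnedAt … n ψ` (`A°ₙ[0] = klPairArrayF n`,
`tₙ[0] = 0`).  So step 3 (`pairLadderStepAtV17F2_of_pairTransferPinnedAt`, p581707) and the model lines of the pinned weight read the relative family unchanged. -/
theorem pairTransferPinnedAt_of_rel {G : GeoConsts} {P : SplitConsts} {r β U μ : ℝ} {n : ℕ} {Tb : TorusSite 2 L → TorusSite 2 L → TorusSite 2 L → ℝ}
    {ψ : FreqMomentum L M → ℝ} (h : PairTransferRelAt L M β U μ n Tb ψ (fun _ => 0))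
    (hle : ∀ Qm k k', Tb Qm k k' ≤ transferBarAt L G P r β U n Qm k k') : PairTransferPinnedAt L M G P r β U μ n ψ := by
  intro Qm hQm
  obtain ⟨N, h1, -, hbd⟩ := h Qm hQm
  have hw : (fun p => ((klTransferWeight L M β μ (klFlowFrameU L M β U μ n) n ψ Qm p -
      klTransferWeight L M β μ (klFlowFrameU L M β U μ n) n (fun _ => 0) Qm p : ℝ) : ℂ)) =
      fun p => (klTransferWeight L M β μ (klFlowFrameU L M β U μ n) n ψ Qm p : ℂ) := by
    funext p; rw [klTransferWeight_zero_symbol, sub_zero]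
  rw [hw, klMemberArrayF_zero] at h1
  refine ⟨N, h1, fun k hk k' hk' => ?_⟩
  have hb := hbd k hk k' hk'
  rw [klMemberArrayF_zero, klMemberArrayF_apply_of_mem β U μ n ψ Qm hk hk'] at hb
  exact hb.trans (hle Qm k k')

/-- **The relative family gives rev 2's pinned family** whenever its bars at the pairs `(ψ | 0)` are dominated by `transferBarAt … n`. -/
theorem PairTransferRelFamily.pinnedFamily {G : GeoConsts} {P : SplitConsts} {r β U μ : ℝ} {n : ℕ}
    {TB : (FreqMomentum L M → ℝ) → (FreqMomentum L M → ℝ) → TorusSite 2 L → TorusSite 2 L → TorusSite 2 L → ℝ}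
    (h : PairTransferRelFamily L M β U μ n TB)
    (hle : ∀ ψ, IsSoftSymbol L M β μ (klFlowFrameU L M β U μ n) n ψ → ∀ Qm k k', TB ψ (fun _ => 0) Qm k k' ≤ transferBarAt L G P r β U n Qm k k') :
    PairTransferPinnedFamily L M G P r β U μ n := fun ψ hψ =>
  pairTransferPinnedAt_of_rel (h ψ (fun _ => 0) hψ (isSoftSymbol_zero β μ _ n) fun k => (hψ.1 k).1) (hle ψ hψ)

end Relative

end Summit.HubbardSuperconductivity.HubbardSuperconductivity.Theorems.KLRegimeSplit

end
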